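import Mathlib

/-!
# Route LevelSetModeration — crux `LevelSetClosure`: real-variable glue of the extinction argument

Helper file for item stmt-NavierStokesRegularity-18150 (line `Sketch-ideator2`, volume bookkeeping):
the five pure-real lemmas consumed by the PDE-free extinction theorem — absorption of the combined
level-set inequality (`absorb`), the large-level threshold (`threshold`), and the `Real.rpow`
bookkeeping turning the two-level volume step into Stampacchia's recurrence, its base and its size
condition (`recursionAlgebra`, `baseAlgebra`, `thresholdAlgebra`). Closed by the registered tools
stub `stub_extinctionAlgebra` (conjunction).
-/

noncomputable section

-- single-conjunct summit: `Summit.<Summit>.<Problem>` repeats the name by the D-0017 layout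
set_option linter.dupNamespace false

open Set Filter Topology

namespace Summit.NavierStokesRegularity.NavierStokesRegularity.Theorems.LevelSetClosure

/-- **Absorption (pure real).** If `e t + 2ν d t ≤ 2 √A √dT` for all `t ∈ [0,T)` with `e, d ≥ 0`,
and `dT` is the supremum-type limit of `d` (`dT ≤ r` whenever every `d t ≤ r`), then
`dT ≤ A/ν²` and `e t ≤ 2A/ν`. -/
theorem absorb (ν A dT T : ℝ) (e d : ℝ → ℝ) (hν : 0 < ν) (hA : 0 ≤ A) (hdT : 0 ≤ dT)
    (he : ∀ t ∈ Ico 0 T, 0 ≤ e t) (hd0 : ∀ t ∈ Ico 0 T, 0 ≤ d t)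
    (hcli : ∀ t ∈ Ico 0 T, e t + 2 * ν * d t ≤ 2 * (Real.sqrt A * Real.sqrt dT))
    (hsup : ∀ r, 0 ≤ r → (∀ t ∈ Ico 0 T, d t ≤ r) → dT ≤ r) :
    dT ≤ A / ν ^ 2 ∧ ∀ t ∈ Ico 0 T, e t ≤ 2 * A / ν := by
  have hsA := Real.sqrt_nonneg A
  have hsD := Real.sqrt_nonneg dT
  -- every `d t ≤ √A √dT / ν`
  have hd : ∀ t ∈ Ico 0 T, d t ≤ Real.sqrt A * Real.sqrt dT / ν := by
    intro t ht
    have h1 := hcli t ht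
    have h2 := he t ht
    rw [le_div_iff₀ hν]
    nlinarith
  have hdT1 : dT ≤ Real.sqrt A * Real.sqrt dT / ν := hsup _ (by positivity) hd
  -- hence `√dT ≤ √A / ν`
  have hsq : Real.sqrt dT ≤ Real.sqrt A / ν := by
    by_cases h0 : Real.sqrt dT = 0
    · rw [h0]; positivity
    · have hpos : 0 < Real.sqrt dT := lt_of_le_of_ne hsD (Ne.symm h0)
      have h3 : Real.sqrt dT * Real.sqrt dT ≤ Real.sqrt A / ν * Real.sqrt dT := by
        calc Real.sqrt dT * Real.sqrt dT = dT := Real.mul_self_sqrt hdT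
          _ ≤ Real.sqrt A * Real.sqrt dT / ν := hdT1
          _ = Real.sqrt A / ν * Real.sqrt dT := by ring
      exact le_of_mul_le_mul_right h3 hpos
  have hdT2 : dT ≤ A / ν ^ 2 := by
    have h4 : Real.sqrt dT ^ 2 ≤ (Real.sqrt A / ν) ^ 2 := pow_le_pow_left₀ hsD hsq 2
    rwa [Real.sq_sqrt hdT, div_pow, Real.sq_sqrt hA] at h4
  refine ⟨hdT2, fun t ht => ?_⟩
  have h1 := hcli t ht
  have h5 : 0 ≤ 2 * ν * d t := by
    have := hd0 t ht
    positivity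
  have h7 : Real.sqrt A * Real.sqrt dT ≤ Real.sqrt A * (Real.sqrt A / ν) :=
    mul_le_mul_of_nonneg_left hsq hsA
  have h8 : Real.sqrt A * (Real.sqrt A / ν) = A / ν := by
    rw [← mul_div_assoc, Real.mul_self_sqrt hA]
  calc e t ≤ 2 * (Real.sqrt A * Real.sqrt dT) - 2 * ν * d t := by linarith
    _ ≤ 2 * (Real.sqrt A * Real.sqrt dT) := by linarith
    _ ≤ 2 * (A / ν) := by rw [← h8]; linarith
    _ = 2 * A / ν := by ring

/-- **Threshold (pure real).** For `m < 10/3` the power `M ^ (5m/3 - 50/9)` decays, so any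
multiple of it is eventually `≤ 1`. -/
theorem threshold (Θ m M₁ : ℝ) (hm : m < 10 / 3) :
    ∃ M : ℝ, M₁ ≤ M ∧ 1 ≤ M ∧ Θ * M ^ (5 * m / 3 - 50 / 9) ≤ 1 := by
  have he : 0 < -(5 * m / 3 - 50 / 9) := by linarith
  have ht : Tendsto (fun M : ℝ => M ^ (5 * m / 3 - 50 / 9)) atTop (𝓝 0) := by
    have := tendsto_rpow_neg_atTop he
    simpa using this
  have ht2 : Tendsto (fun M : ℝ => Θ * M ^ (5 * m / 3 - 50 / 9)) atTop (𝓝 0) := by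
    simpa using ht.const_mul Θ
  have hev : ∀ᶠ M in atTop, Θ * M ^ (5 * m / 3 - 50 / 9) ≤ 1 :=
    (ht2.eventually (Iic_mem_nhds zero_lt_one)).mono fun M hM => hM
  obtain ⟨M, hM⟩ := (hev.and ((eventually_ge_atTop M₁).and (eventually_ge_atTop 1))).exists
  exact ⟨M, hM.2.1, hM.2.2, hM.1⟩

/-- **Recursion algebra (pure real).** Inserting the absorbed bounds `S = 2ΛM^m V(k)/ν`,
`D(T,k) ≤ ΛM^m V(k)/ν²` into the two-level volume step gives the Stampacchia recurrence shape
`V(h) ≤ C_M (h-k)^{-10/3} V(k)^{5/3}`, `C_M = Γ (M^m)^{5/3}`. -/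
theorem recursionAlgebra (Λ ν M m k h Kr Vh Vk Dk : ℝ) (hΛ : 0 < Λ) (hν : 0 < ν) (hM : 0 < M)
    (hkh : k < h) (hVk : 0 ≤ Vk)
    (hV : Vh ≤ (4 / (h - k)) ^ (10 / 3 : ℝ) * Kr ^ 2 * (2 * Λ * M ^ m * Vk / ν) ^ (2 / 3 : ℝ) * Dk)
    (hD : Dk ≤ Λ * M ^ m * Vk / ν ^ 2) :
    Vh ≤ (4 : ℝ) ^ (10 / 3 : ℝ) * Kr ^ 2 * (2 * Λ / ν) ^ (2 / 3 : ℝ) * (Λ / ν ^ 2) *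
      (M ^ m) ^ (5 / 3 : ℝ) / (h - k) ^ (10 / 3 : ℝ) * Vk ^ (5 / 3 : ℝ) := by
  have hhk : 0 < h - k := sub_pos.2 hkh
  have hMm : 0 < M ^ m := Real.rpow_pos_of_pos hM m
  have h1 : (4 / (h - k)) ^ (10 / 3 : ℝ) = (4 : ℝ) ^ (10 / 3 : ℝ) / (h - k) ^ (10 / 3 : ℝ) :=
    Real.div_rpow (by norm_num) hhk.le _
  have h2 : (2 * Λ * M ^ m * Vk / ν) ^ (2 / 3 : ℝ) =
      (2 * Λ / ν) ^ (2 / 3 : ℝ) * (M ^ m) ^ (2 / 3 : ℝ) * Vk ^ (2 / 3 : ℝ) := by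
    rw [show 2 * Λ * M ^ m * Vk / ν = (2 * Λ / ν) * M ^ m * Vk by ring,
      Real.mul_rpow (by positivity) hVk, Real.mul_rpow (by positivity) hMm.le]
  have h3 : (M ^ m) ^ (5 / 3 : ℝ) = (M ^ m) ^ (2 / 3 : ℝ) * M ^ m := by
    rw [show (5 / 3 : ℝ) = 2 / 3 + 1 by norm_num, Real.rpow_add hMm, Real.rpow_one]
  have h4 : Vk ^ (5 / 3 : ℝ) = Vk ^ (2 / 3 : ℝ) * Vk := by
    rw [show (5 / 3 : ℝ) = 2 / 3 + 1 by norm_num, Real.rpow_add' hVk (by norm_num), Real.rpow_one]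
  have hP : 0 ≤ (4 / (h - k)) ^ (10 / 3 : ℝ) * Kr ^ 2 * (2 * Λ * M ^ m * Vk / ν) ^ (2 / 3 : ℝ) := by
    positivity
  calc Vh ≤ (4 / (h - k)) ^ (10 / 3 : ℝ) * Kr ^ 2 * (2 * Λ * M ^ m * Vk / ν) ^ (2 / 3 : ℝ) * Dk := hV
    _ ≤ (4 / (h - k)) ^ (10 / 3 : ℝ) * Kr ^ 2 * (2 * Λ * M ^ m * Vk / ν) ^ (2 / 3 : ℝ) *
          (Λ * M ^ m * Vk / ν ^ 2) := mul_le_mul_of_nonneg_left hD hP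
    _ = _ := by rw [h1, h2, h3, h4]; ring

/-- **Base algebra (pure real).** The floor two-level step
`V(M/2) ≤ (4/(M/2 - M₀/2))^{10/3} Kr² E₀^{2/3} D₀` gives
`V(M/2) ≤ 16^{10/3} Kr² E₀^{2/3} D₀ · M^{-10/3}` for `M ≥ 2M₀`. -/
theorem baseAlgebra (M M₀ Kr E₀ D₀ Vhalf : ℝ) (hM₀ : 0 < M₀) (hM : 2 * M₀ ≤ M)
    (hE₀ : 0 ≤ E₀) (hD₀ : 0 ≤ D₀)
    (hV : Vhalf ≤ (4 / (M / 2 - M₀ / 2)) ^ (10 / 3 : ℝ) * Kr ^ 2 * E₀ ^ (2 / 3 : ℝ) * D₀) :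
    Vhalf ≤ (16 : ℝ) ^ (10 / 3 : ℝ) * Kr ^ 2 * E₀ ^ (2 / 3 : ℝ) * D₀ * M ^ (-(10 / 3 : ℝ)) := by
  have hMpos : 0 < M := by linarith
  have hgap : 0 < M / 2 - M₀ / 2 := by linarith
  have hle : 4 / (M / 2 - M₀ / 2) ≤ 16 / M := by
    rw [div_le_div_iff₀ hgap hMpos]; nlinarith
  have h1 : (4 / (M / 2 - M₀ / 2)) ^ (10 / 3 : ℝ) ≤ (16 / M) ^ (10 / 3 : ℝ) :=
    Real.rpow_le_rpow (by positivity) hle (by norm_num)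
  have h2 : (16 / M) ^ (10 / 3 : ℝ) = (16 : ℝ) ^ (10 / 3 : ℝ) * M ^ (-(10 / 3 : ℝ)) := by
    rw [Real.div_rpow (by norm_num) hMpos.le, Real.rpow_neg hMpos.le, div_eq_mul_inv]
  have hQ : 0 ≤ Kr ^ 2 * E₀ ^ (2 / 3 : ℝ) * D₀ := by positivity
  calc Vhalf ≤ (4 / (M / 2 - M₀ / 2)) ^ (10 / 3 : ℝ) * Kr ^ 2 * E₀ ^ (2 / 3 : ℝ) * D₀ := hV
    _ = (4 / (M / 2 - M₀ / 2)) ^ (10 / 3 : ℝ) * (Kr ^ 2 * E₀ ^ (2 / 3 : ℝ) * D₀) := by ring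
    _ ≤ (16 / M) ^ (10 / 3 : ℝ) * (Kr ^ 2 * E₀ ^ (2 / 3 : ℝ) * D₀) :=
        mul_le_mul_of_nonneg_right h1 hQ
    _ = _ := by rw [h2]; ring

/-- **Threshold algebra (pure real).** With `V(M/2) ≤ C_b M^{-10/3}` and
`Γ C_b^{2/3} 2^{35/3} M^{5m/3 - 50/9} ≤ 1`, `M ≥ 1`, Stampacchia's size condition
`C_M V(M/2)^{β-1} 2^{αβ/(β-1)} ≤ (M/2)^α` holds (`α = 10/3`, `β = 5/3`, `C_M = Γ (M^m)^{5/3}`). -/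
theorem thresholdAlgebra (Γ Cb Vhalf M m : ℝ) (hΓ : 0 ≤ Γ) (hCb : 0 ≤ Cb) (hV0 : 0 ≤ Vhalf)
    (hM : 1 ≤ M) (hVh : Vhalf ≤ Cb * M ^ (-(10 / 3 : ℝ)))
    (hΘ : Γ * Cb ^ (2 / 3 : ℝ) * (2 : ℝ) ^ (35 / 3 : ℝ) * M ^ (5 * m / 3 - 50 / 9) ≤ 1) :
    Γ * (M ^ m) ^ (5 / 3 : ℝ) * Vhalf ^ ((5 / 3 : ℝ) - 1) *
        (2 : ℝ) ^ ((10 / 3 : ℝ) * (5 / 3) / ((5 / 3 : ℝ) - 1)) ≤ (M / 2) ^ (10 / 3 : ℝ) := by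
  have hMpos : 0 < M := by linarith
  have e1 : (5 / 3 : ℝ) - 1 = 2 / 3 := by norm_num
  rw [e1, show (10 / 3 : ℝ) * (5 / 3) / (2 / 3) = 25 / 3 by norm_num]
  -- `V(M/2)^{2/3} ≤ C_b^{2/3} M^{-20/9}`
  have h1 : Vhalf ^ (2 / 3 : ℝ) ≤ Cb ^ (2 / 3 : ℝ) * M ^ (-(20 / 9 : ℝ)) := by
    calc Vhalf ^ (2 / 3 : ℝ) ≤ (Cb * M ^ (-(10 / 3 : ℝ))) ^ (2 / 3 : ℝ) :=
          Real.rpow_le_rpow hV0 hVh (by norm_num)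
      _ = Cb ^ (2 / 3 : ℝ) * M ^ (-(20 / 9 : ℝ)) := by
          rw [Real.mul_rpow hCb (Real.rpow_nonneg hMpos.le _), ← Real.rpow_mul hMpos.le]
          norm_num
  -- `(M^m)^{5/3} = M^{5m/3}`
  have h2 : (M ^ m) ^ (5 / 3 : ℝ) = M ^ (5 * m / 3) := by
    rw [← Real.rpow_mul hMpos.le]; ring_nf
  -- `(M/2)^{10/3} = 2^{-10/3} M^{10/3}`
  have h3 : (M / 2) ^ (10 / 3 : ℝ) = M ^ (10 / 3 : ℝ) * (2 : ℝ) ^ (-(10 / 3 : ℝ)) := by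
    rw [Real.div_rpow hMpos.le (by norm_num), Real.rpow_neg (by norm_num : (0:ℝ) ≤ 2),
      div_eq_mul_inv]
  -- powers of `M` and of `2`
  have hM1 : M ^ (5 * m / 3) * M ^ (-(20 / 9 : ℝ)) =
      M ^ (5 * m / 3 - 50 / 9) * M ^ (10 / 3 : ℝ) := by
    rw [← Real.rpow_add hMpos, ← Real.rpow_add hMpos]; ring_nf
  have h2pow : (2 : ℝ) ^ (25 / 3 : ℝ) = (2 : ℝ) ^ (35 / 3 : ℝ) * (2 : ℝ) ^ (-(10 / 3 : ℝ)) := by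
    rw [← Real.rpow_add (by norm_num : (0:ℝ) < 2)]; norm_num
  calc Γ * (M ^ m) ^ (5 / 3 : ℝ) * Vhalf ^ (2 / 3 : ℝ) * (2 : ℝ) ^ (25 / 3 : ℝ)
      ≤ Γ * (M ^ m) ^ (5 / 3 : ℝ) * (Cb ^ (2 / 3 : ℝ) * M ^ (-(20 / 9 : ℝ))) *
          (2 : ℝ) ^ (25 / 3 : ℝ) := by
        gcongr
    _ = (Γ * Cb ^ (2 / 3 : ℝ) * (2 : ℝ) ^ (35 / 3 : ℝ) * M ^ (5 * m / 3 - 50 / 9)) *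
          (M ^ (10 / 3 : ℝ) * (2 : ℝ) ^ (-(10 / 3 : ℝ))) := by
        have hre : Γ * (M ^ m) ^ (5 / 3 : ℝ) * (Cb ^ (2 / 3 : ℝ) * M ^ (-(20 / 9 : ℝ))) *
            (2 : ℝ) ^ (25 / 3 : ℝ) =
            Γ * Cb ^ (2 / 3 : ℝ) * (2 : ℝ) ^ (25 / 3 : ℝ) * (M ^ (5 * m / 3) * M ^ (-(20 / 9 : ℝ))) := by
          rw [h2]; ring
        rw [hre, hM1, h2pow]; ring
    _ ≤ 1 * (M ^ (10 / 3 : ℝ) * (2 : ℝ) ^ (-(10 / 3 : ℝ))) :=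
        mul_le_mul_of_nonneg_right hΘ (by positivity)
    _ = (M / 2) ^ (10 / 3 : ℝ) := by rw [h3, one_mul]

/-- **Registered tools stub `stub_extinctionAlgebra`**: the conjunction of the five real-variable
lemmas of this file (absorption, threshold, recursion/base/threshold algebra). -/
theorem stub_extinctionAlgebra :
    (∀ (ν A dT T : ℝ) (e d : ℝ → ℝ), 0 < ν → 0 ≤ A → 0 ≤ dT →
      (∀ t ∈ Set.Ico 0 T, 0 ≤ e t) → (∀ t ∈ Set.Ico 0 T, 0 ≤ d t) →
      (∀ t ∈ Set.Ico 0 T, e t + 2 * ν * d t ≤ 2 * (Real.sqrt A * Real.sqrt dT)) →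
      (∀ r, 0 ≤ r → (∀ t ∈ Set.Ico 0 T, d t ≤ r) → dT ≤ r) →
      dT ≤ A / ν ^ 2 ∧ ∀ t ∈ Set.Ico 0 T, e t ≤ 2 * A / ν) ∧
    (∀ (Θ m M₁ : ℝ), m < 10 / 3 →
      ∃ M : ℝ, M₁ ≤ M ∧ 1 ≤ M ∧ Θ * M ^ (5 * m / 3 - 50 / 9) ≤ 1) ∧
    (∀ (Λ ν M m k h Kr Vh Vk Dk : ℝ), 0 < Λ → 0 < ν → 0 < M → k < h → 0 ≤ Vk →
      Vh ≤ (4 / (h - k)) ^ (10 / 3 : ℝ) * Kr ^ 2 * (2 * Λ * M ^ m * Vk / ν) ^ (2 / 3 : ℝ) * Dk →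
      Dk ≤ Λ * M ^ m * Vk / ν ^ 2 →
      Vh ≤ (4 : ℝ) ^ (10 / 3 : ℝ) * Kr ^ 2 * (2 * Λ / ν) ^ (2 / 3 : ℝ) * (Λ / ν ^ 2) *
        (M ^ m) ^ (5 / 3 : ℝ) / (h - k) ^ (10 / 3 : ℝ) * Vk ^ (5 / 3 : ℝ)) ∧
    (∀ (M M₀ Kr E₀ D₀ Vhalf : ℝ), 0 < M₀ → 2 * M₀ ≤ M → 0 ≤ E₀ → 0 ≤ D₀ →
      Vhalf ≤ (4 / (M / 2 - M₀ / 2)) ^ (10 / 3 : ℝ) * Kr ^ 2 * E₀ ^ (2 / 3 : ℝ) * D₀ →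
      Vhalf ≤ (16 : ℝ) ^ (10 / 3 : ℝ) * Kr ^ 2 * E₀ ^ (2 / 3 : ℝ) * D₀ * M ^ (-(10 / 3 : ℝ))) ∧
    (∀ (Γ Cb Vhalf M m : ℝ), 0 ≤ Γ → 0 ≤ Cb → 0 ≤ Vhalf → 1 ≤ M →
      Vhalf ≤ Cb * M ^ (-(10 / 3 : ℝ)) →
      Γ * Cb ^ (2 / 3 : ℝ) * (2 : ℝ) ^ (35 / 3 : ℝ) * M ^ (5 * m / 3 - 50 / 9) ≤ 1 →
      Γ * (M ^ m) ^ (5 / 3 : ℝ) * Vhalf ^ ((5 / 3 : ℝ) - 1) *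
          (2 : ℝ) ^ ((10 / 3 : ℝ) * (5 / 3) / ((5 / 3 : ℝ) - 1)) ≤ (M / 2) ^ (10 / 3 : ℝ)) :=
  ⟨absorb, threshold, recursionAlgebra, baseAlgebra, thresholdAlgebra⟩

end Summit.NavierStokesRegularity.NavierStokesRegularity.Theorems.LevelSetClosure

end
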